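import Mathlib
import HarnessLib
import Summits.HubbardSuperconductivity.HubbardSuperconductivity.Theorems.KLProgrammeKLRegimeWickLegDressingModel
import Summits.HubbardSuperconductivity.HubbardSuperconductivity.Theorems.KLProgrammeKLRegimeWickStepLines

/-!
# Route `KLProgramme` — ENGINE child (stmt-HubbardSuperconductivity-19918 / gen-6 `KLRegimeEngineV15`), stub `stub_engine_step_values`, (E2):
# the ONE-LINE term of the Wick step at the pair labels in closed form (E2-WICK-ROADMAP §5 (iii-e), the step instance; cell gate-hubbard-kl, seat p1 g9)

The `j = 1` term of `klw_wickPairAmplitude_succ_lines` (p504266) is `𝒱₄[dblFold((Δ_×(D_n) − Δ_×(D_{n+1}))(𝒲_n⁰𝒲_n¹))](Z)`; by additivity of the cross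
Laplacian in the covariance and `D_n = D_{n+1} + g_{n+1}` it is the one-line term of the SLICE `g_{n+1}`, and `vertexFn_dblFold_oneLine` (p505192) evaluates
it: **`klw_wickPairAmplitude_succ_oneLine_term`** —
`𝒱₄[dblFold((Δ_×(D_n)^1)(𝒲⁰𝒲¹) − (Δ_×(D_{n+1})^1)(𝒲⁰𝒲¹))](k′↑+, Q−k′↓+, Q−k↓−, k↑−)
   = 2·(βL²)⁻¹ · 𝒞^W_n(Q;k,k′) · (s(ω₀,k′)Σ^W(ω₀,k′;↑) + s(−ω₀,Q−k′)Σ^W(−ω₀,Q−k′;↓) + s(−ω₀,Q−k)Σ^W(−ω₀,Q−k;↓) + s(ω₀,k)Σ^W(ω₀,k;↑))`,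
`s(p) = (χ_{Λ_{n+1}}(p) − χ_{Λ_n}(p))·βL²·ĝ_K(p)` the slice line value (`contr_klSliceCov_eq_diagContr`), `Σ^W = klWickSelfEnergy … n`: the four external legs
of the Wick pair amplitude dressed by the slice line × the Wick self-energy at their own momenta — nonzero only for legs on the slice support
(the `legSliceCountT` count of (E2-v9)/(E2-v10)).  Proved; no definitions; exact identity.
-/

noncomputable section

namespace Summit.HubbardSuperconductivity.HubbardSuperconductivity.Theorems.KLRegimeWick

set_option linter.dupNamespace false -- summit = problem name (single-conjunct summit), D-0017

open Literature.MathematicalPhysics.QuantumLattice GrassmannAlgebra Finset Matrix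
open Literature.Probability.LatticeModels
open Summit.HubbardSuperconductivity.HubbardSuperconductivity.Theorems.TwoPointAssembly
open Summit.HubbardSuperconductivity.HubbardSuperconductivity.Theorems.KLProgrammeLegKernels
open Summit.HubbardSuperconductivity.HubbardSuperconductivity.Theorems.KLRegimeSplit

section Model

variable (L M : ℕ) [NeZero L] [NeZero M] (β U μ : ℝ) (K : TrigPolyC4v)

omit [NeZero M] in
/-- **The one-line operator of the step is the slice's**: `Δ_×(D_n) P − Δ_×(D_{n+1}) P = Δ_×(g_{n+1}) P`. -/
theorem klw_crossLaplacian_softCov_sub (n : ℕ) (P : GrassmannAlgebra ℂ (HubbardFieldIdx L M × Fin 2)) :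
    (grassmannLaplacian ℂ (crossCov ℂ (klSoftCov L M β μ K n)) ^ 1) P - (grassmannLaplacian ℂ (crossCov ℂ (klSoftCov L M β μ K (n + 1))) ^ 1) P =
      grassmannLaplacian ℂ (crossCov ℂ (klSliceCov L M β μ K (n + 1))) P := by
  rw [pow_one, pow_one, klw_softCov_eq_succ_add_slice L M β μ K n, grassmannLaplacian_crossCov_add, LinearMap.add_apply, add_sub_cancel_left]

/-- **`klw_wickPairAmplitude_succ_oneLine_term`** — the `j = 1` term of `klw_wickPairAmplitude_succ_lines` in closed form: the Wick pair amplitude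
times the slice-line × Wick-self-energy dressing of its four external legs (see the module docstring). -/
theorem klw_wickPairAmplitude_succ_oneLine_term (hβ : β ≠ 0) (n : ℕ) (Q k k' : TorusSite 2 L) :
    vertexFn L M β (dblFold ℂ
        ((grassmannLaplacian ℂ (crossCov ℂ (klSoftCov L M β μ K n)) ^ 1)
            (dblCopy ℂ 0 (klWickAction L M β U μ K n) * dblCopy ℂ 1 (klWickAction L M β U μ K n)) -
          (grassmannLaplacian ℂ (crossCov ℂ (klSoftCov L M β μ K (n + 1))) ^ 1)
            (dblCopy ℂ 0 (klWickAction L M β U μ K n) * dblCopy ℂ 1 (klWickAction L M β U μ K n)))) 4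
        ![(((omega0 M, k'), 0), 0), ((((omega0 M).rev, Q - k'), 1), 0), ((((omega0 M).rev, Q - k), 1), 1), (((omega0 M, k), 0), 1)] =
      2 * (((β * (L : ℝ) ^ 2 : ℝ) : ℂ))⁻¹ * klWickPairAmplitude L M β U μ K n Q k k' *
        (((hubbardCutoffWeightCT L M β μ K (klScale klE0 (n + 1)) (omega0 M, k') -
              hubbardCutoffWeightCT L M β μ K (klScale klE0 n) (omega0 M, k') : ℝ) : ℂ) *
            (((β * (L : ℝ) ^ 2 : ℝ) : ℂ) * propCT L M β μ K (omega0 M, k')) * klWickSelfEnergy L M β U μ K n (omega0 M, k') 0 +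
          ((hubbardCutoffWeightCT L M β μ K (klScale klE0 (n + 1)) ((omega0 M).rev, Q - k') -
              hubbardCutoffWeightCT L M β μ K (klScale klE0 n) ((omega0 M).rev, Q - k') : ℝ) : ℂ) *
            (((β * (L : ℝ) ^ 2 : ℝ) : ℂ) * propCT L M β μ K ((omega0 M).rev, Q - k')) * klWickSelfEnergy L M β U μ K n ((omega0 M).rev, Q - k') 1 +
          ((hubbardCutoffWeightCT L M β μ K (klScale klE0 (n + 1)) ((omega0 M).rev, Q - k) -
              hubbardCutoffWeightCT L M β μ K (klScale klE0 n) ((omega0 M).rev, Q - k) : ℝ) : ℂ) *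
            (((β * (L : ℝ) ^ 2 : ℝ) : ℂ) * propCT L M β μ K ((omega0 M).rev, Q - k)) * klWickSelfEnergy L M β U μ K n ((omega0 M).rev, Q - k) 1 +
          ((hubbardCutoffWeightCT L M β μ K (klScale klE0 (n + 1)) (omega0 M, k) -
              hubbardCutoffWeightCT L M β μ K (klScale klE0 n) (omega0 M, k) : ℝ) : ℂ) *
            (((β * (L : ℝ) ^ 2 : ℝ) : ℂ) * propCT L M β μ K (omega0 M, k)) * klWickSelfEnergy L M β U μ K n (omega0 M, k) 0) := by
  rw [klw_crossLaplacian_softCov_sub,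
    vertexFn_dblFold_oneLine β U μ K hβ (contr_klSliceCov_eq_diagContr hβ μ K (n + 1)) n, klWickPairAmplitude]
  simp only [Fin.sum_univ_four, Matrix.cons_val_zero, Matrix.cons_val_one, Matrix.head_cons, Matrix.cons_val_two, Matrix.tail_cons,
    Matrix.cons_val_three, Nat.add_sub_cancel]

end Model

end Summit.HubbardSuperconductivity.HubbardSuperconductivity.Theorems.KLRegimeWick

end
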